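import Literature.AlgebraicGeometry.AbelianSchemes.TupleIsoPointCriteria
import Literature.AlgebraicGeometry.AbelianSchemes.TupleIsoAtOfFibreIsoPoints
import HarnessLib

/-!
# Isomorphism of MFK tuples along `𝟙 T` is SYMMETRIC (the five clauses — level ∕ `X`, `X̂`, Poincaré, `λ`, `𝒪`-action — invert)

Topic `AlgebraicGeometry/AbelianSchemes`; namespace `Literature.AlgebraicGeometry.AbelianSchemes.AbelianSchemeOver`.  THEOREMS ONLY (no def, no
instance, no notation, no named fact, no `sorry`).  Cell hodgecm-mathlib (D-0151), P6 «MOD programme» (crux hLiu418 = stmt-HodgeConjecture-24832,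
`--supports`, count-neutral): organ for the P-line mint `stub_INJ` TRANSPORT (LEAD F0P6-plan (g3) «M-48»; A-p13 (g37)) — the transport
`tupleIsoAt (genPt y₁) (genPt y₂) T-tuple → tupleIsoAt (ℓ y₁) (ℓ y₂) E-tuple` composes the given isomorphism with `gen_iso y₂` and with the INVERSE of
`gen_iso y₁`; transitivity is ★ `tupleRel_comp_id_id`, this file supplies the inverse.  HC_CM is proved only modulo the printed citations until rung 0
closes; nothing here is about HC.

THE MATHEMATICS ([MumfordFogartyKirwan1994] Ch. 7 §2 Def. 7.2–7.3: «isomorphism of triples» is an equivalence relation).  Over a reduced connected locally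
Noetherian `T` with both Poincaré sheaves normalised along `Aᵢ × {ε}`: the five clauses along `𝟙 T` for `(G, Ĝ)` from tuple 1 to tuple 2 come from an
isomorphism of group schemes `e` exact on `λ` in dual form, level and action (★ `exists_iso_of_tupleRel_id`); `e⁻¹` is exact on `λ` the other way (★
`inv_comp_lam_comp_dualIsogenyOver_inv_of_eq`), carries the level sections and the action back; ★ Layer A `isoOfTriples_id_of_iso` on `e⁻¹` yields the five
clauses from tuple 2 to tuple 1 (with `Ĝ′ := Ĥ_{e⁻¹}`).

## References
* [MumfordFogartyKirwan1994] D. Mumford, J. Fogarty, F. Kirwan, *Geometric Invariant Theory*, 3rd ed. (1994), Ch. 7 §2 Def. 7.2 (p. 129), Def. 7.3 (p. 130).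
* [MilneAV2008] J. S. Milne, *Abelian Varieties* (2008), I §8 pp. 36–37, I §9 Thm. 9.1 (p. 42).
-/

set_option autoImplicit false

noncomputable section

-- Mathlib's `Over`/pull-back API is stated across semireducible wrappers (as in the ★ `AbelianSchemes/*` files).
set_option backward.isDefEq.respectTransparency false

universe u

open CategoryTheory CategoryTheory.Limits AlgebraicGeometry MonoidalCategory
open scoped MonObj

namespace Literature.AlgebraicGeometry.AbelianSchemes

namespace AbelianSchemeOver

variable {T : Scheme.{u}} [IsReduced T] [IsLocallyNoetherian T] [PreconnectedSpace T] {A₁ A₂ : AbelianSchemeOver T}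
  (D₁ : A₁.DualPair) (D₂ : A₂.DualPair)
  (lam₁ : A₁.X ⟶ D₁.hat.X) (lam₂ : A₂.X ⟶ D₂.hat.X) [IsMonHom lam₁]
  (hD₁ : Nonempty ((Scheme.Modules.pullback (DualPair.unitHatSlice D₁)).obj D₁.P ≅ SheafOfModules.unit _))
  (hD₂ : Nonempty ((Scheme.Modules.pullback (DualPair.unitHatSlice D₂)).obj D₂.P ≅ SheafOfModules.unit _))
  {g n : ℕ} (φ₁ : A₁.LevelStructure g n) (φ₂ : A₂.LevelStructure g n)
  {O : Type*} (act₁ : O → (A₁.X ⟶ A₁.X)) (act₂ : O → (A₂.X ⟶ A₂.X))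

include hD₁ hD₂ in
/-- **ISOMORPHISM OF TUPLES ALONG `𝟙 T` IS SYMMETRIC.**  Over a reduced connected locally Noetherian `T` (e.g. a geometric point), with both Poincaré
sheaves normalised along `Aᵢ × {ε}` (automatic for polarisations, ★ `Polarization.nonempty_unitHatSlice_iso`): if `(G, Ĝ)` satisfies the five clauses of
[MumfordFogartyKirwan1994] Def. 7.2–7.3 along `𝟙 T` FROM `(A₁, λ₁, (Â₁, 𝒫₁), φ₁, ι₁)` TO `(A₂, λ₂, (Â₂, 𝒫₂), φ₂, ι₂)` (level ∕ `X`, `X̂`, Poincaré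
`(G × Ĝ)^*𝒫₂ ≅ 𝒫₁`, `λ₁ ≫ Ĝ = G ≫ λ₂`, `ι₁(a) ≫ G = G ≫ ι₂(a)`), then some `(G′, Ĝ′)` satisfies them FROM tuple 2 TO tuple 1 (`G′ = G⁻¹`,
`Ĝ′ = Ĥ_{G⁻¹}`).  ★ `exists_iso_of_tupleRel_id` ∘ ★ `inv_comp_lam_comp_dualIsogenyOver_inv_of_eq` ∘ ★ Layer A `isoOfTriples_id_of_iso`.
[cite: MumfordFogartyKirwan1994, Ch. 7 §2 Definition 7.2 (p. 129) and Definition 7.3 (p. 130)] [cite: MilneAV2008, I §8 pp. 36–37] -/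
theorem exists_tupleRel_id_symm {G : A₁.X.left ⟶ A₂.X.left} {Ĝ : D₁.hat.X.left ⟶ D₂.hat.X.left}
    (h : φ₁.IsBaseChangeVia φ₂ (𝟙 T) G ∧ D₁.hat.IsBaseChangeVia D₂.hat (𝟙 T) Ĝ ∧
      (∃ (wG : A₁.X.hom ≫ 𝟙 T = G ≫ A₂.X.hom) (wĜ : D₁.hat.X.hom ≫ 𝟙 T = Ĝ ≫ D₂.hat.X.hom),
        Nonempty ((Scheme.Modules.pullback
          (pullback.map A₁.X.hom D₁.hat.X.hom A₂.X.hom D₂.hat.X.hom G Ĝ (𝟙 T) wG wĜ)).obj D₂.P ≅ D₁.P)) ∧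
      lam₁.left ≫ Ĝ = G ≫ lam₂.left ∧ ∀ a : O, (act₁ a).left ≫ G = G ≫ (act₂ a).left) :
    ∃ (G' : A₂.X.left ⟶ A₁.X.left) (Ĝ' : D₂.hat.X.left ⟶ D₁.hat.X.left),
      φ₂.IsBaseChangeVia φ₁ (𝟙 T) G' ∧ D₂.hat.IsBaseChangeVia D₁.hat (𝟙 T) Ĝ' ∧
      (∃ (wG : A₂.X.hom ≫ 𝟙 T = G' ≫ A₁.X.hom) (wĜ : D₂.hat.X.hom ≫ 𝟙 T = Ĝ' ≫ D₁.hat.X.hom),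
        Nonempty ((Scheme.Modules.pullback
          (pullback.map A₂.X.hom D₂.hat.X.hom A₁.X.hom D₁.hat.X.hom G' Ĝ' (𝟙 T) wG wĜ)).obj D₁.P ≅ D₂.P)) ∧
      lam₂.left ≫ Ĝ' = G' ≫ lam₁.left ∧ ∀ a : O, (act₂ a).left ≫ G' = G' ≫ (act₁ a).left := by
  obtain ⟨e, he, -, -, hlam, hσ, hact⟩ := exists_iso_of_tupleRel_id D₁ D₂ lam₁ lam₂ hD₂ φ₁ φ₂ act₁ act₂ h
  haveI := he
  haveI : IsMonHom e.symm.hom := (inferInstance : IsMonHom e.inv)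
  have hlam' : e.symm.hom ≫ lam₁ ≫ DualPair.dualIsogenyOver e.symm.hom D₂ D₁ = lam₂ :=
    inv_comp_lam_comp_dualIsogenyOver_inv_of_eq D₁ D₂ lam₁ lam₂ hD₂ e hlam
  have hσ' : ∀ i, φ₂.σ i ≫ e.symm.hom = φ₁.σ i := fun i => by
    rw [← hσ i, Category.assoc, Iso.symm_hom, Iso.hom_inv_id, Category.comp_id]
  have hact' : ∀ a, act₂ a ≫ e.symm.hom = e.symm.hom ≫ act₁ a := fun a => by
    rw [Iso.symm_hom, Iso.comp_inv_eq, Category.assoc, Iso.eq_inv_comp, hact a]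
  exact ⟨_, _, isoOfTriples_id_of_iso D₂ D₁ lam₂ lam₁ hD₂ hD₁ φ₂ φ₁ act₂ act₁ e.symm hlam' hσ' hact'⟩

end AbelianSchemeOver

end Literature.AlgebraicGeometry.AbelianSchemes

end
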